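import Literature.Combinatorics.AssociationSchemes.JohnsonHarmonicsBiased
import HarnessLib

/-!
# The level-`j` inequality on a slice `C([n],t)` at EVERY `0 < t < n`, by transfer from the `t/n`-biased cube

The tree's `SliceLevelInequality.slice_level_pow_le` / `slice_level_sq_le` / `slice_layer_sq_le_log` transplant O'Donnell's
level-`k` inequality to the slice through the UNIFORM cube; their transfer factor `transferLambda n t j` is quantitative only on
balanced slices (`SliceLevelInequality §6`: `64 ≤ n ≤ 4t`). This module runs the same Hölder route
(`SliceLevelInequality.pow_avg_mul_le`) on the slice Bonami lemma at bias `p = t/n`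
(`JohnsonHarmonicsBiased.slice_bonami_layer_expect`), which holds at every `0 < t < n`:

* §1 **`slice_level_pow_le_biased`** (moment form): for `0 ≤ f ≤ 1` on the `t`-sets with mean `μ`, `q` harmonic of degree
  `j ≤ t`, `t + j ≤ n`, `r ≥ 1`, `K = (2r−1)·max(p,1−p)/min(p,1−p)`, `Λ_b = transferLambdaBiased n t j = C(n,t)·Λ_p`:
  `(Σ_{|U|=t} f zeta q)^{2r} ≤ μ^{2r−1}·(n+1)·K^{rj}·(Λ_b Σ_{|U|=t} (zeta q)²)^r`;
  **`slice_level_sq_le_biased`** (its `r`-th root): `(Σ f zeta q)² ≤ μ^{2−1/r}·(n+1)^{1/r}·K^j·Λ_b·Σ (zeta q)²`;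
  **`slice_layer_sq_le_biased`** (projection form, `f = Σ_i zeta p_i` on the slice):
  `Σ_{|U|=t} (zeta p_j U)² ≤ μ^{2−1/r}·(n+1)^{1/r}·K^j·Λ_b`, i.e. `W_j[f] = ‖f^{=j}‖²/C(n,t) ≤ μ^{2−1/r} (n+1)^{1/r} K^j Λ_p`;
* §2 `transferRatio_eq`: `Λ_p = transferRatio n t j (t/n) = (p(1−p))^j·C(n,t)/C(n−2j,t−j)`
  (`= (p(1−p))^j n^{(2j)}/(t^{(j)}(n−t)^{(j)})`), and **`transferRatio_le_four_pow`**: `Λ_p ≤ 4^j` whenever `2j ≤ t` and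
  `2j ≤ n − t`.
* §3 (appended) **`slice_level_sq_le_log_biased`** / **`slice_layer_sq_le_log_biased`** — the logarithmic forms at
  `r = ⌈ln(1/μ)/j⌉ + 1`: `(Σ f·zeta q)² ≤ Λ_b μ² (e·(n+1)^{1/(ln(1/μ)+j)}·κ_p·(2 ln(1/μ)/j + 3))^j Σ (zeta q)²` and
  `‖f^{=j}‖² ≤ Λ_b μ² (…)^j`, `κ_p = max(p,1−p)/min(p,1−p)`.
* §4 (appended) **`slice_layer_weight_le_biased`** / **`slice_layer_weight_le_log_biased`** — the same with the explicit
  constant in the middle of the range (`2j ≤ min(t,n−t)`, `Λ_p ≤ 4^j`): `W_j[f] ≤ μ^{2−1/r}(n+1)^{1/r}(4K)^j` and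
  `W_j[f] ≤ μ²(4e (n+1)^{1/(L+j)} κ_p (2L/j+3))^j`.

So, with `r = ⌈ln(1/μ)/j⌉ + 1` and `κ = max(t,n−t)/min(t,n−t)`: `W_j[f] ≤ e·μ²·(n+1)^{1/r}·(4(2r−1)κ)^j` — O'Donnell's
`μ²(Cκ ln(1/μ)/j)^j` at every bias, at the price `(n+1)^{1/r} ≤ (n+1)^{j/ln(1/μ)}` of conditioning `μ_p` on `|V| = t`
[cite: ODonnell2014, §9.5 (level-k inequalities), Thm. 10.21 (general product spaces)]. Cell pnp-psdrank (LIT-29 §2, eng MEMO-15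
§2.2 «missing input»): the cut-pair side of PairSNT₁ needs level inequalities on slices far from `t = n/2` and on multislices; this
is the slice half. Everything is PROVED; no facts, no instances/notation; standard axioms. Label: support / instrument.
WHAT THIS IS NOT: not the multislice / product-of-slices statement; nothing about matchings, psd rank or P vs NP.
-/

noncomputable section

namespace Literature.Combinatorics.AssociationSchemes.SliceLevelInequalityBiased

open Finset
open Literature.Combinatorics.AssociationSchemes.JohnsonHarmonics
open Literature.Combinatorics.AssociationSchemes.JohnsonSpectrum
open Literature.Combinatorics.AssociationSchemes.SliceLevelInequality
open Literature.Combinatorics.AssociationSchemes.JohnsonHarmonicsBiased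

variable {n : ℕ}

/-! ### §1 The level-`j` inequality on the slice at every `0 < t < n` (Hölder route, all biases) -/

/-- The transfer factor of the all-bias level-`j` inequality in the tree's (sum) normalisation:
`Λ_b(n,t,j) = C(n,t) · transferRatio n t j (t/n) = (p(1−p))^j · C(n,t)² · (t−j)!/ff(n−2j,t−j)`, `p = t/n`
(the analogue of `SliceLevelInequality.transferLambda`). [cite: ODonnell2014, §9.5] -/
def transferLambdaBiased (n t j : ℕ) : ℝ := (n.choose t : ℝ) * transferRatio n t j ((t : ℝ) / n)

/-- `Λ_p = transferRatio n t j (t/n) > 0` for `0 < t < n`, `j ≤ t`, `t + j ≤ n`. [cite: FilmusMossel2019, Thm. 3.9] -/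
theorem transferRatio_pos {t j : ℕ} (ht0 : 0 < t) (htn : t < n) (hjt : j ≤ t) (htj : t + j ≤ n) :
    0 < transferRatio n t j ((t : ℝ) / n) := by
  unfold transferRatio
  have hn' : (0 : ℝ) < n := by exact_mod_cast (lt_of_le_of_lt (Nat.zero_le t) htn)
  have hp0 : 0 < (t : ℝ) / n := div_pos (by exact_mod_cast ht0) hn'
  have hp1 : (t : ℝ) / n < 1 := by rw [div_lt_one hn']; exact_mod_cast htn
  have h1p : 0 < 1 - (t : ℝ) / n := by linarith
  have hC : (0 : ℝ) < (n.choose t : ℝ) := by exact_mod_cast Nat.choose_pos htn.le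
  have hff : 0 < ff ((n : ℝ) - 2 * j) (t - j) := ff_sub_pos hjt htj
  have hfact : (0 : ℝ) < ((t - j).factorial : ℝ) := by exact_mod_cast Nat.factorial_pos _
  positivity

/-- `Λ_b > 0`. [cite: ODonnell2014, §9.5] -/
theorem transferLambdaBiased_pos {t j : ℕ} (ht0 : 0 < t) (htn : t < n) (hjt : j ≤ t) (htj : t + j ≤ n) :
    0 < transferLambdaBiased n t j := by
  unfold transferLambdaBiased
  have hC : (0 : ℝ) < (n.choose t : ℝ) := by exact_mod_cast Nat.choose_pos htn.le
  exact mul_pos hC (transferRatio_pos ht0 htn hjt htj)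

/-- **The level-`j` inequality on the slice `{|U| = t}` at every `0 < t < n`, moment form.** For `0 ≤ f ≤ 1` on the
`t`-subsets of `[n]` with mean `μ = sliceMean n t f`, every harmonic `q` of degree `j ≤ t` with `t + j ≤ n`, every `r ≥ 1`,
`p = t/n`, `K = (2r−1)·max(p,1−p)/min(p,1−p)` and `Λ_b = transferLambdaBiased n t j`:
`(Σ_{|U|=t} f(U) zeta q U)^{2r} ≤ μ^{2r−1} · (n+1)·K^{rj} · (Λ_b · Σ_{|U|=t} (zeta q U)²)^r`
— O'Donnell's level-`k` inequality by the Hölder route (`SliceLevelInequality.pow_avg_mul_le`) fed with the slice Bonami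
lemma `slice_bonami_layer_expect` instead of the uniform-cube transfer; compare `SliceLevelInequality.slice_level_pow_le`
(there `(2r−1)^{rj}` and `transferLambda`, quantitative only for `n ≤ 4t`). [cite: ODonnell2014, §9.5 + Thm. 10.21] -/
theorem slice_level_pow_le_biased {j t : ℕ} (ht0 : 0 < t) (htn : t < n) (hjt : j ≤ t) (htj : t + j ≤ n)
    {q : Finset (Fin n) → ℝ} (hq : IsHarmonic j q) (f : Finset (Fin n) → ℝ)
    (hf0 : ∀ U : Finset (Fin n), U.card = t → 0 ≤ f U) (hf1 : ∀ U : Finset (Fin n), U.card = t → f U ≤ 1)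
    (r : ℕ) (hr : 1 ≤ r) :
    (∑ U ∈ univ.powersetCard t, f U * zeta q U) ^ (2 * r) ≤
      sliceMean n t f ^ (2 * r - 1) *
        ((n + 1 : ℝ) * ((2 * r - 1 : ℝ) * (max ((t : ℝ) / n) (1 - (t : ℝ) / n) / min ((t : ℝ) / n) (1 - (t : ℝ) / n))) ^ (r * j)) *
          (transferLambdaBiased n t j * ∑ U ∈ univ.powersetCard t, zeta q U ^ 2) ^ r := by
  set p : ℝ := (t : ℝ) / n with hp
  set K : ℝ := (2 * r - 1 : ℝ) * (max p (1 - p) / min p (1 - p))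
  set C : ℝ := (n.choose t : ℝ) with hC_def
  set S : ℝ := ∑ U ∈ univ.powersetCard t, zeta q U ^ 2
  set μ : ℝ := sliceMean n t f with hμ_def
  have hC : 0 < C := by rw [hC_def]; exact_mod_cast Nat.choose_pos htn.le
  have hsum : ∑ U ∈ univ.powersetCard t, f U = C * μ := by
    rw [hμ_def, sliceMean, ← hC_def, mul_div_cancel₀ _ hC.ne']
  -- Hölder
  have h1 := pow_avg_mul_le (univ.powersetCard t) f (fun U => zeta q U)
    (fun U hU => hf0 U (mem_powersetCard.1 hU).2) (fun U hU => hf1 U (mem_powersetCard.1 hU).2) hC hsum r hr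
  -- slice Bonami for the layer, expectation form
  have h2 := slice_bonami_layer_expect ht0 htn hjt htj hq r hr
  have hμ0 : 0 ≤ μ := sliceMean_nonneg hf0
  have h12 : ((∑ U ∈ univ.powersetCard t, f U * zeta q U) / C) ^ (2 * r) ≤
      μ ^ (2 * r - 1) * ((n + 1 : ℝ) * K ^ (r * j) * (transferRatio n t j p * (S / C)) ^ r) :=
    h1.trans (mul_le_mul_of_nonneg_left h2 (pow_nonneg hμ0 _))
  rw [div_pow, div_le_iff₀ (pow_pos hC _)] at h12
  refine h12.trans (le_of_eq ?_)
  unfold transferLambdaBiased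
  rw [← hp, ← hC_def, show C ^ (2 * r) = (C * C) ^ r by rw [← sq, ← pow_mul], mul_assoc (μ ^ (2 * r - 1)), mul_assoc (μ ^ (2 * r - 1)),
    mul_assoc ((n + 1 : ℝ) * K ^ (r * j)), ← mul_pow]
  congr 3
  field_simp

/-- **The level-`j` inequality on the slice at every `0 < t < n`** (the `r`-th root of the moment form): with the notation
of `slice_level_pow_le_biased`,
`(Σ_{|U|=t} f(U) zeta q U)² ≤ μ^{2 − 1/r} · (n+1)^{1/r} · K^j · Λ_b · Σ_{|U|=t} (zeta q U)²`.
Choosing `r ≍ ln(1/μ)/j` gives the familiar `μ² (C κ ln(1/μ)/j)^j`, `κ = max(p,1−p)/min(p,1−p)`, times `(n+1)^{j/ln(1/μ)}`.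
[cite: ODonnell2014, §9.5 + Thm. 10.21] -/
theorem slice_level_sq_le_biased {j t : ℕ} (ht0 : 0 < t) (htn : t < n) (hjt : j ≤ t) (htj : t + j ≤ n)
    {q : Finset (Fin n) → ℝ} (hq : IsHarmonic j q) (f : Finset (Fin n) → ℝ)
    (hf0 : ∀ U : Finset (Fin n), U.card = t → 0 ≤ f U) (hf1 : ∀ U : Finset (Fin n), U.card = t → f U ≤ 1)
    (r : ℕ) (hr : 1 ≤ r) :
    (∑ U ∈ univ.powersetCard t, f U * zeta q U) ^ 2 ≤
      sliceMean n t f ^ ((2 : ℝ) - 1 / r) *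
        ((n + 1 : ℝ) ^ ((1 : ℝ) / r) * ((2 * r - 1 : ℝ) * (max ((t : ℝ) / n) (1 - (t : ℝ) / n) / min ((t : ℝ) / n) (1 - (t : ℝ) / n))) ^ j) *
          (transferLambdaBiased n t j * ∑ U ∈ univ.powersetCard t, zeta q U ^ 2) := by
  have h := slice_level_pow_le_biased ht0 htn hjt htj hq f hf0 hf1 r hr
  set p : ℝ := (t : ℝ) / n with hp
  set K : ℝ := (2 * r - 1 : ℝ) * (max p (1 - p) / min p (1 - p)) with hK
  set μ := sliceMean n t f with hμ_def
  have hn' : (0 : ℝ) < n := by exact_mod_cast (lt_of_le_of_lt (Nat.zero_le t) htn)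
  have hp0 : 0 < p := by rw [hp]; exact div_pos (by exact_mod_cast ht0) hn'
  have hp1 : p < 1 := by rw [hp, div_lt_one hn']; exact_mod_cast htn
  have hμ0 : 0 ≤ μ := sliceMean_nonneg hf0
  have hK0 : 0 ≤ K := by
    have h2r0 : (0 : ℝ) ≤ 2 * r - 1 := by
      have : (1 : ℝ) ≤ r := by exact_mod_cast hr
      linarith
    have : 0 < min p (1 - p) := lt_min hp0 (by linarith)
    have : 0 ≤ max p (1 - p) := hp0.le.trans (le_max_left _ _)
    positivity
  have hΛN : 0 ≤ transferLambdaBiased n t j * ∑ U ∈ univ.powersetCard t, zeta q U ^ 2 :=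
    mul_nonneg (transferLambdaBiased_pos ht0 htn hjt htj).le (sum_nonneg fun U _ => sq_nonneg _)
  have hr0 : r ≠ 0 := by omega
  have hn1 : (0 : ℝ) ≤ (n + 1 : ℝ) := by positivity
  -- `(μ^{2 − 1/r})^r = μ^{2r−1}` and `((n+1)^{1/r})^r = n+1`
  have hμpow : (μ ^ ((2 : ℝ) - 1 / r)) ^ r = μ ^ (2 * r - 1) := by
    rw [← Real.rpow_natCast, ← Real.rpow_mul hμ0]
    have hexp : ((2 : ℝ) - 1 / r) * r = ((2 * r - 1 : ℕ) : ℝ) := by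
      rw [Nat.cast_sub (by omega), Nat.cast_mul, Nat.cast_two, Nat.cast_one]
      field_simp
    rw [hexp, Real.rpow_natCast]
  have hnpow : ((n + 1 : ℝ) ^ ((1 : ℝ) / r)) ^ r = (n + 1 : ℝ) := by
    rw [← Real.rpow_natCast, ← Real.rpow_mul hn1, show (1 : ℝ) / r * r = 1 by field_simp, Real.rpow_one]
  refine (pow_le_pow_iff_left₀ (sq_nonneg _) (by positivity) hr0).mp ?_
  rw [← pow_mul, mul_pow, mul_pow, mul_pow, ← pow_mul, mul_comm j r, hμpow, hnpow]
  exact h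

/-- **Projection form at every `0 < t < n`**: for `0 ≤ f ≤ 1` on the `t`-sets with mean `μ`, written there as a sum of
harmonic layers `f = Σ_{i≤t} zeta p_i`, and `j ≤ t`, `t + j ≤ n`, `r ≥ 1`:
`Σ_{|U|=t} (zeta p_j U)² ≤ μ^{2−1/r} · (n+1)^{1/r} · K^j · Λ_b` — the norm of the degree-`j` layer itself, i.e.
`W_j[f] = ‖f^{=j}‖²/C(n,t) ≤ μ^{2−1/r} (n+1)^{1/r} K^j · Λ_p` with `Λ_p = transferRatio n t j (t/n)`.
[cite: ODonnell2014, §9.5 + Thm. 10.21] -/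
theorem slice_layer_sq_le_biased {j t : ℕ} (ht0 : 0 < t) (htn : t < n) (hjt : j ≤ t) (htj : t + j ≤ n)
    (p : ℕ → Finset (Fin n) → ℝ) (hp : ∀ i, IsHarmonic i (p i)) (f : Finset (Fin n) → ℝ)
    (hf0 : ∀ U : Finset (Fin n), U.card = t → 0 ≤ f U) (hf1 : ∀ U : Finset (Fin n), U.card = t → f U ≤ 1)
    (hdec : ∀ U ∈ univ.powersetCard t, f U = ∑ i ∈ range (t + 1), zeta (p i) U) (r : ℕ) (hr : 1 ≤ r) :
    ∑ U ∈ univ.powersetCard t, zeta (p j) U ^ 2 ≤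
      sliceMean n t f ^ ((2 : ℝ) - 1 / r) *
        ((n + 1 : ℝ) ^ ((1 : ℝ) / r) * ((2 * r - 1 : ℝ) * (max ((t : ℝ) / n) (1 - (t : ℝ) / n) / min ((t : ℝ) / n) (1 - (t : ℝ) / n))) ^ j) *
          transferLambdaBiased n t j := by
  set N := ∑ U ∈ univ.powersetCard t, zeta (p j) U ^ 2 with hN_def
  set B := sliceMean n t f ^ ((2 : ℝ) - 1 / r) *
        ((n + 1 : ℝ) ^ ((1 : ℝ) / r) * ((2 * r - 1 : ℝ) * (max ((t : ℝ) / n) (1 - (t : ℝ) / n) / min ((t : ℝ) / n) (1 - (t : ℝ) / n))) ^ j) *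
          transferLambdaBiased n t j with hB_def
  have h := slice_level_sq_le_biased ht0 htn hjt htj (hp j) f hf0 hf1 r hr
  rw [sum_mul_zeta_layer_eq_sq hjt p hp f hdec, ← hN_def, ← mul_assoc, ← hB_def] at h
  -- `h : N² ≤ B·N`
  have hN0 : 0 ≤ N := sum_nonneg fun U _ => sq_nonneg _
  have hB0 : 0 ≤ B := by
    have hn' : (0 : ℝ) < n := by exact_mod_cast (lt_of_le_of_lt (Nat.zero_le t) htn)
    have hp0 : 0 < (t : ℝ) / n := div_pos (by exact_mod_cast ht0) hn'
    have hp1 : (t : ℝ) / n < 1 := by rw [div_lt_one hn']; exact_mod_cast htn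
    have hμ0 : 0 ≤ sliceMean n t f := sliceMean_nonneg hf0
    have h2r0 : (0 : ℝ) ≤ 2 * r - 1 := by
      have : (1 : ℝ) ≤ r := by exact_mod_cast hr
      linarith
    have hmin : 0 < min ((t : ℝ) / n) (1 - (t : ℝ) / n) := lt_min hp0 (by linarith)
    have hmax : 0 ≤ max ((t : ℝ) / n) (1 - (t : ℝ) / n) := hp0.le.trans (le_max_left _ _)
    have hΛ := transferLambdaBiased_pos ht0 htn hjt htj
    have h1 : 0 ≤ sliceMean n t f ^ ((2 : ℝ) - 1 / r) := Real.rpow_nonneg hμ0 _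
    have h2 : 0 ≤ (n + 1 : ℝ) ^ ((1 : ℝ) / r) := Real.rpow_nonneg (by positivity) _
    rw [hB_def]
    positivity
  rcases hN0.eq_or_lt with hz | hpos
  · rw [← hz]; exact hB0
  · have h' : N * N ≤ B * N := by rw [← sq]; exact h
    exact le_of_mul_le_mul_right h' hpos

/-! ### §2 The transfer ratio in closed form; `Λ_p ≤ 4^j` in the middle of the range -/

/-- `ff(n−2j, t−j) = (t−j)! · C(n−2j, t−j)` for `j ≤ t`, `t + j ≤ n`. [cite: ODonnell2014, §1.4] -/
theorem ff_sub_eq_factorial_mul_choose {t j : ℕ} (hjt : j ≤ t) (htj : t + j ≤ n) :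
    ff ((n : ℝ) - 2 * j) (t - j) = ((t - j).factorial : ℝ) * (((n - 2 * j).choose (t - j) : ℕ) : ℝ) := by
  rw [show ((n : ℝ) - 2 * j) = ((n - 2 * j : ℕ) : ℝ) by rw [Nat.cast_sub (by omega)]; push_cast; ring,
    ← ff_natCast_div_factorial]
  have hf : ((t - j).factorial : ℝ) ≠ 0 := by exact_mod_cast (Nat.factorial_pos _).ne'
  field_simp

/-- **The transfer ratio in closed form**: `Λ_p = transferRatio n t j (t/n) = (p(1−p))^j · C(n,t)/C(n−2j,t−j)`
(`= (p(1−p))^j · n^{(2j)}/(t^{(j)}(n−t)^{(j)})` by `SliceLevelInequality.choose_mul_descFactorial_mul_descFactorial`).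
[cite: FilmusMossel2019, Thm. 3.9] -/
theorem transferRatio_eq {t j : ℕ} (hjt : j ≤ t) (htj : t + j ≤ n) (x : ℝ) :
    transferRatio n t j x = (x * (1 - x)) ^ j * (n.choose t : ℝ) / (((n - 2 * j).choose (t - j) : ℕ) : ℝ) := by
  unfold transferRatio
  rw [ff_sub_eq_factorial_mul_choose hjt htj]
  have hf : ((t - j).factorial : ℝ) ≠ 0 := by exact_mod_cast (Nat.factorial_pos _).ne'
  have hc : ((((n - 2 * j).choose (t - j) : ℕ) : ℝ)) ≠ 0 := by
    exact_mod_cast (Nat.choose_pos (show t - j ≤ n - 2 * j by omega)).ne'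
  field_simp

/-- **`Λ_p ≤ 4^j` in the middle of the range**: for `2j ≤ t` and `2j ≤ n − t` (and `0 < t < n`),
`transferRatio n t j (t/n) ≤ 4^j` — since `C(n,t)/C(n−2j,t−j) = n^{(2j)}/(t^{(j)}(n−t)^{(j)}) ≤ n^{2j}/((t/2)^j((n−t)/2)^j)`.
[cite: FilmusMossel2019, Thm. 3.9; ODonnell2014, §1.4] -/
theorem transferRatio_le_four_pow {t j : ℕ} (htn : t < n) (h2jt : 2 * j ≤ t) (h2jnt : 2 * j ≤ n - t) :
    transferRatio n t j ((t : ℝ) / n) ≤ 4 ^ j := by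
  have hjt : j ≤ t := by omega
  have htj : t + j ≤ n := by omega
  rw [transferRatio_eq hjt htj]
  have hn' : (0 : ℝ) < n := by exact_mod_cast (lt_of_le_of_lt (Nat.zero_le t) htn)
  have hcpos : (0 : ℝ) < (((n - 2 * j).choose (t - j) : ℕ) : ℝ) := by
    exact_mod_cast Nat.choose_pos (show t - j ≤ n - 2 * j by omega)
  rw [div_le_iff₀ hcpos]
  -- the falling-factorial identity and bounds, in `ℝ`
  have hid : (n.choose t : ℝ) * (t.descFactorial j : ℝ) * ((n - t).descFactorial j : ℝ) =
      (((n - 2 * j).choose (t - j) : ℕ) : ℝ) * (n.descFactorial (2 * j) : ℝ) := by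
    exact_mod_cast choose_mul_descFactorial_mul_descFactorial hjt htj
  have hdn : (n.descFactorial (2 * j) : ℝ) ≤ (n : ℝ) ^ (2 * j) := by exact_mod_cast Nat.descFactorial_le_pow n (2 * j)
  have hdt : ((t + 1 - j : ℕ) : ℝ) ^ j ≤ (t.descFactorial j : ℝ) := by
    exact_mod_cast Nat.pow_sub_le_descFactorial t j
  have hdnt : ((n - t + 1 - j : ℕ) : ℝ) ^ j ≤ ((n - t).descFactorial j : ℝ) := by
    exact_mod_cast Nat.pow_sub_le_descFactorial (n - t) j
  -- `t ≤ 2(t+1−j)` and `n−t ≤ 2(n−t+1−j)`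
  have ht' : (t : ℝ) ≤ n := by exact_mod_cast htn.le
  have h2t : (t : ℝ) ≤ 2 * ((t + 1 - j : ℕ) : ℝ) := by
    rw [Nat.cast_sub (by omega)]; push_cast
    have : (2 * j : ℝ) ≤ t := by exact_mod_cast h2jt
    linarith
  have h2nt : ((n : ℝ) - t) ≤ 2 * ((n - t + 1 - j : ℕ) : ℝ) := by
    rw [Nat.cast_sub (by omega)]; push_cast; rw [Nat.cast_sub htn.le]
    have : (2 * j : ℝ) ≤ ((n - t : ℕ) : ℝ) := by exact_mod_cast h2jnt
    rw [Nat.cast_sub htn.le] at this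
    linarith
  have ht0' : (0 : ℝ) ≤ t := by positivity
  have hnt0 : (0 : ℝ) ≤ (n : ℝ) - t := by linarith
  -- `(t(n−t))^j ≤ 4^j · t^{(j)} (n−t)^{(j)}`
  have hprod : ((t : ℝ) * ((n : ℝ) - t)) ^ j ≤ (4 : ℝ) ^ j * ((t.descFactorial j : ℝ) * ((n - t).descFactorial j : ℝ)) := by
    calc ((t : ℝ) * ((n : ℝ) - t)) ^ j ≤ ((2 * ((t + 1 - j : ℕ) : ℝ)) * (2 * ((n - t + 1 - j : ℕ) : ℝ))) ^ j :=
          pow_le_pow_left₀ (by positivity) (mul_le_mul h2t h2nt hnt0 (by positivity)) j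
      _ = (4 : ℝ) ^ j * ((((t + 1 - j : ℕ) : ℝ)) ^ j * (((n - t + 1 - j : ℕ) : ℝ)) ^ j) := by
          rw [mul_pow, mul_pow, mul_pow, show (4 : ℝ) ^ j = 2 ^ j * 2 ^ j by rw [← mul_pow]; norm_num]; ring
      _ ≤ (4 : ℝ) ^ j * ((t.descFactorial j : ℝ) * ((n - t).descFactorial j : ℝ)) := by
          gcongr
  -- assemble: `(p(1−p))^j C(n,t) = (t(n−t))^j C / n^{2j} ≤ 4^j t^{(j)}(n−t)^{(j)} C / n^{2j} = 4^j C' n^{(2j)}/n^{2j} ≤ 4^j C'`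
  have hp : ((t : ℝ) / n * (1 - (t : ℝ) / n)) ^ j = ((t : ℝ) * ((n : ℝ) - t)) ^ j / (n : ℝ) ^ (2 * j) := by
    rw [pow_mul, ← div_pow, sq]; congr 1; field_simp
  rw [hp, div_mul_eq_mul_div, div_le_iff₀ (by positivity)]
  have hC0 : (0 : ℝ) ≤ (n.choose t : ℝ) := by positivity
  calc ((t : ℝ) * ((n : ℝ) - t)) ^ j * (n.choose t : ℝ)
      ≤ (4 : ℝ) ^ j * ((t.descFactorial j : ℝ) * ((n - t).descFactorial j : ℝ)) * (n.choose t : ℝ) :=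
        mul_le_mul_of_nonneg_right hprod hC0
    _ = (4 : ℝ) ^ j * ((n.choose t : ℝ) * (t.descFactorial j : ℝ) * ((n - t).descFactorial j : ℝ)) := by ring
    _ = (4 : ℝ) ^ j * ((((n - 2 * j).choose (t - j) : ℕ) : ℝ) * (n.descFactorial (2 * j) : ℝ)) := by rw [hid]
    _ ≤ (4 : ℝ) ^ j * ((((n - 2 * j).choose (t - j) : ℕ) : ℝ) * (n : ℝ) ^ (2 * j)) := by gcongr
    _ = (4 : ℝ) ^ j * (((n - 2 * j).choose (t - j) : ℕ) : ℝ) * (n : ℝ) ^ (2 * j) := by ring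

/-! ### §3 Logarithmic form: `r = ⌈ln(1/μ)/j⌉ + 1` -/

/-- **The level-`j` inequality on the slice at every `0 < t < n`, logarithmic form** (`j ≥ 1`): with `μ = sliceMean n t f`,
`L = ln(1/μ)`, `κ_p = max(p,1−p)/min(p,1−p)` (`p = t/n`) and `Λ_b = transferLambdaBiased n t j`:
`(Σ_{|U|=t} f·zeta q)² ≤ Λ_b · μ² · (e · (n+1)^{1/(L+j)} · κ_p · (2L/j + 3))^j · Σ_{|U|=t} (zeta q)²`
— `slice_level_sq_le_biased` at `r = ⌈L/j⌉ + 1` (`μ^{−1/r} ≤ e^j`, `2r − 1 ≤ 2L/j + 3`, `(n+1)^{1/r} ≤ (n+1)^{j/(L+j)}`); compare the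
tree's `SliceLevelInequality.slice_level_sq_le_log` (uniform-cube transfer: `Λ μ² (e(2L/j+3))^j`, quantitative for `n ≤ 4t` only).
[cite: ODonnell2014, §9.5 + Thm. 10.21] -/
theorem slice_level_sq_le_log_biased {j t : ℕ} (hj : 1 ≤ j) (ht0 : 0 < t) (htn : t < n) (hjt : j ≤ t) (htj : t + j ≤ n)
    {q : Finset (Fin n) → ℝ} (hq : IsHarmonic j q) (f : Finset (Fin n) → ℝ)
    (hf0 : ∀ U : Finset (Fin n), U.card = t → 0 ≤ f U) (hf1 : ∀ U : Finset (Fin n), U.card = t → f U ≤ 1) :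
    (∑ U ∈ univ.powersetCard t, f U * zeta q U) ^ 2 ≤
      transferLambdaBiased n t j * sliceMean n t f ^ 2 *
        (Real.exp 1 * (n + 1 : ℝ) ^ (1 / (Real.log (1 / sliceMean n t f) + j)) *
          (max ((t : ℝ) / n) (1 - (t : ℝ) / n) / min ((t : ℝ) / n) (1 - (t : ℝ) / n)) *
          (2 * Real.log (1 / sliceMean n t f) / j + 3)) ^ j *
        ∑ U ∈ univ.powersetCard t, zeta q U ^ 2 := by
  set μ := sliceMean n t f with hμ_def
  set N := ∑ U ∈ univ.powersetCard t, zeta q U ^ 2 with hN_def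
  set κ : ℝ := max ((t : ℝ) / n) (1 - (t : ℝ) / n) / min ((t : ℝ) / n) (1 - (t : ℝ) / n) with hκ_def
  have htn' : t ≤ n := htn.le
  have hμ0 : 0 ≤ μ := sliceMean_nonneg hf0
  have hμ1 : μ ≤ 1 := sliceMean_le_one hf1
  have hΛ := transferLambdaBiased_pos ht0 htn hjt htj
  have hN0 : 0 ≤ N := sum_nonneg fun U _ => sq_nonneg _
  have hjpos : (0 : ℝ) < j := by exact_mod_cast hj
  have hn' : (0 : ℝ) < n := by exact_mod_cast (lt_of_le_of_lt (Nat.zero_le t) htn)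
  have hp0 : 0 < (t : ℝ) / n := div_pos (by exact_mod_cast ht0) hn'
  have hp1 : (t : ℝ) / n < 1 := by rw [div_lt_one hn']; exact_mod_cast htn
  have hκ0 : 0 ≤ κ := by
    have : 0 < min ((t : ℝ) / n) (1 - (t : ℝ) / n) := lt_min hp0 (by linarith)
    have : 0 ≤ max ((t : ℝ) / n) (1 - (t : ℝ) / n) := hp0.le.trans (le_max_left _ _)
    rw [hκ_def]; positivity
  rcases hμ0.eq_or_lt with hμz | hμpos
  · rw [sum_mul_eq_zero_of_sliceMean_eq_zero htn' hf0 hμz.symm, ← hμz]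
    simp
  set L := Real.log (1 / μ) with hL_def
  have hL0 : 0 ≤ L := Real.log_nonneg (by rw [le_div_iff₀ hμpos, one_mul]; exact hμ1)
  set r : ℕ := ⌈L / j⌉₊ + 1 with hr_def
  have hr : 1 ≤ r := by omega
  have h := slice_level_sq_le_biased ht0 htn hjt htj hq f hf0 hf1 r hr
  have hrpos : (0 : ℝ) < r := by exact_mod_cast (by omega : 0 < r)
  have hrj : (r : ℝ) = ⌈L / j⌉₊ + 1 := by rw [hr_def]; push_cast; ring
  -- `μ^{2 − 1/r} ≤ μ² e^j`
  have h1 : μ ^ ((2 : ℝ) - 1 / r) ≤ μ ^ 2 * Real.exp 1 ^ j := by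
    rw [sub_eq_add_neg, Real.rpow_add hμpos, Real.rpow_two, Real.exp_one_pow]
    refine mul_le_mul_of_nonneg_left ?_ (sq_nonneg _)
    rw [Real.rpow_def_of_pos hμpos, Real.exp_le_exp]
    have hlog : Real.log μ = -L := by rw [hL_def, one_div, Real.log_inv, neg_neg]
    rw [hlog, show -L * -(1 / (r : ℝ)) = L / r by ring, div_le_iff₀ hrpos]
    have hceil : L / j ≤ ⌈L / j⌉₊ := Nat.le_ceil _
    rw [div_le_iff₀ hjpos] at hceil
    nlinarith
  -- `2r − 1 ≤ 2L/j + 3`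
  have h2 : (2 * r - 1 : ℝ) ≤ 2 * L / j + 3 := by
    have hceil : (⌈L / j⌉₊ : ℝ) < L / j + 1 := Nat.ceil_lt_add_one (div_nonneg hL0 hjpos.le)
    rw [hrj]
    have : 2 * L / j = 2 * (L / j) := by ring
    linarith
  have h2r0 : (0 : ℝ) ≤ 2 * r - 1 := by
    have : (1 : ℝ) ≤ r := by exact_mod_cast hr
    linarith
  have h3 : ((2 * r - 1 : ℝ) * κ) ^ j ≤ ((2 * L / j + 3) * κ) ^ j :=
    pow_le_pow_left₀ (mul_nonneg h2r0 hκ0) (mul_le_mul_of_nonneg_right h2 hκ0) j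
  -- `(n+1)^{1/r} ≤ ((n+1)^{1/(L+j)})^j`
  have hn1 : (1 : ℝ) ≤ (n + 1 : ℝ) := by
    have : (0 : ℝ) ≤ n := by positivity
    linarith
  have h4 : (n + 1 : ℝ) ^ ((1 : ℝ) / r) ≤ ((n + 1 : ℝ) ^ (1 / (L + j))) ^ j := by
    rw [← Real.rpow_natCast, ← Real.rpow_mul (by positivity)]
    refine Real.rpow_le_rpow_of_exponent_le hn1 ?_
    rw [show 1 / (L + (j : ℝ)) * (j : ℝ) = 1 / ((L + j) / j) by field_simp]
    refine one_div_le_one_div_of_le (by positivity) ?_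
    rw [hrj, div_le_iff₀ hjpos]
    have hceil : L / j ≤ ⌈L / j⌉₊ := Nat.le_ceil _
    rw [div_le_iff₀ hjpos] at hceil
    nlinarith
  have hA0 : 0 ≤ (n + 1 : ℝ) ^ (1 / (L + j)) := Real.rpow_nonneg (by positivity) _
  calc (∑ U ∈ univ.powersetCard t, f U * zeta q U) ^ 2
      ≤ μ ^ ((2 : ℝ) - 1 / r) * ((n + 1 : ℝ) ^ ((1 : ℝ) / r) * ((2 * r - 1 : ℝ) * κ) ^ j) *
          (transferLambdaBiased n t j * N) := h
    _ ≤ (μ ^ 2 * Real.exp 1 ^ j) * (((n + 1 : ℝ) ^ (1 / (L + j))) ^ j * ((2 * L / j + 3) * κ) ^ j) *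
          (transferLambdaBiased n t j * N) := by
        gcongr
    _ = transferLambdaBiased n t j * μ ^ 2 * (Real.exp 1 * (n + 1 : ℝ) ^ (1 / (L + j)) * κ * (2 * L / j + 3)) ^ j * N := by
        rw [mul_pow, mul_pow, mul_pow, mul_pow]; ring

/-- **Projection form, logarithmic** (`j ≥ 1`): for `0 ≤ f ≤ 1` on the `t`-sets with mean `μ`, written there as `f = Σ_{i≤t} zeta p_i`: `Σ_{|U|=t} (zeta p_j U)² ≤ Λ_b · μ² · (e · (n+1)^{1/(L+j)} · κ_p · (2L/j + 3))^j`, i.e.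
`W_j[f] = ‖f^{=j}‖²/C(n,t) ≤ Λ_p · μ² · (e (n+1)^{1/(ln(1/μ)+j)} κ_p (2 ln(1/μ)/j + 3))^j` with `Λ_p ≤ 4^j` for `2j ≤ min(t, n−t)`
(`transferRatio_le_four_pow`). [cite: ODonnell2014, §9.5 + Thm. 10.21] -/
theorem slice_layer_sq_le_log_biased {j t : ℕ} (hj : 1 ≤ j) (ht0 : 0 < t) (htn : t < n) (hjt : j ≤ t) (htj : t + j ≤ n)
    (p : ℕ → Finset (Fin n) → ℝ) (hp : ∀ i, IsHarmonic i (p i)) (f : Finset (Fin n) → ℝ)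
    (hf0 : ∀ U : Finset (Fin n), U.card = t → 0 ≤ f U) (hf1 : ∀ U : Finset (Fin n), U.card = t → f U ≤ 1)
    (hdec : ∀ U ∈ univ.powersetCard t, f U = ∑ i ∈ range (t + 1), zeta (p i) U) :
    ∑ U ∈ univ.powersetCard t, zeta (p j) U ^ 2 ≤
      transferLambdaBiased n t j * sliceMean n t f ^ 2 *
        (Real.exp 1 * (n + 1 : ℝ) ^ (1 / (Real.log (1 / sliceMean n t f) + j)) *
          (max ((t : ℝ) / n) (1 - (t : ℝ) / n) / min ((t : ℝ) / n) (1 - (t : ℝ) / n)) *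
          (2 * Real.log (1 / sliceMean n t f) / j + 3)) ^ j := by
  set N := ∑ U ∈ univ.powersetCard t, zeta (p j) U ^ 2 with hN_def
  set B := transferLambdaBiased n t j * sliceMean n t f ^ 2 *
        (Real.exp 1 * (n + 1 : ℝ) ^ (1 / (Real.log (1 / sliceMean n t f) + j)) *
          (max ((t : ℝ) / n) (1 - (t : ℝ) / n) / min ((t : ℝ) / n) (1 - (t : ℝ) / n)) *
          (2 * Real.log (1 / sliceMean n t f) / j + 3)) ^ j with hB_def
  have h := slice_level_sq_le_log_biased hj ht0 htn hjt htj (hp j) f hf0 hf1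
  rw [sum_mul_zeta_layer_eq_sq hjt p hp f hdec, ← hN_def, ← hB_def] at h
  -- `h : N² ≤ B·N`
  have hN0 : 0 ≤ N := sum_nonneg fun U _ => sq_nonneg _
  have hμ0 : 0 ≤ sliceMean n t f := sliceMean_nonneg hf0
  have hμ1 : sliceMean n t f ≤ 1 := sliceMean_le_one hf1
  have hB0 : 0 ≤ B := by
    have hn' : (0 : ℝ) < n := by exact_mod_cast (lt_of_le_of_lt (Nat.zero_le t) htn)
    have hp0 : 0 < (t : ℝ) / n := div_pos (by exact_mod_cast ht0) hn'
    have hp1 : (t : ℝ) / n < 1 := by rw [div_lt_one hn']; exact_mod_cast htn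
    have hmin : 0 < min ((t : ℝ) / n) (1 - (t : ℝ) / n) := lt_min hp0 (by linarith)
    have hmax : 0 ≤ max ((t : ℝ) / n) (1 - (t : ℝ) / n) := hp0.le.trans (le_max_left _ _)
    have hL : 0 ≤ 2 * Real.log (1 / sliceMean n t f) / j + 3 := by
      rcases hμ0.eq_or_lt with hz | hpos
      · rw [← hz]; simp
      · have : 0 ≤ Real.log (1 / sliceMean n t f) :=
          Real.log_nonneg (by rw [le_div_iff₀ hpos, one_mul]; exact hμ1)
        positivity
    have hA : 0 ≤ (n + 1 : ℝ) ^ (1 / (Real.log (1 / sliceMean n t f) + j)) := Real.rpow_nonneg (by positivity) _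
    have := transferLambdaBiased_pos ht0 htn hjt htj
    rw [hB_def]; positivity
  rcases hN0.eq_or_lt with hz | hpos
  · rw [← hz]; exact hB0
  · have h' : N * N ≤ B * N := by rw [← sq]; exact h
    exact le_of_mul_le_mul_right h' hpos

/-! ### §4 Explicit constants in the middle of the range (`2j ≤ min(t, n−t)`): `W_j ≤ μ^{2−1/r}(n+1)^{1/r}(4K)^j` -/

/-- **Projection form with explicit constants.** For `0 < t < n`, `2j ≤ t`, `2j ≤ n − t`, `0 ≤ f ≤ 1` on the `t`-sets with mean
`μ` and harmonic layers `f = Σ_i zeta p_i` there, and every `r ≥ 1`: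
`W_j[f] := Σ_{|U|=t} (zeta p_j U)² / C(n,t) ≤ μ^{2−1/r} · (n+1)^{1/r} · (4·(2r−1)·max(p,1−p)/min(p,1−p))^j`, `p = t/n`
(`slice_layer_sq_le_biased` with `Λ_b = C(n,t)·Λ_p` and `Λ_p ≤ 4^j`, `transferRatio_le_four_pow`). [cite: ODonnell2014, §9.5 + Thm. 10.21] -/
theorem slice_layer_weight_le_biased {j t : ℕ} (ht0 : 0 < t) (htn : t < n) (h2jt : 2 * j ≤ t) (h2jnt : 2 * j ≤ n - t)
    (p : ℕ → Finset (Fin n) → ℝ) (hp : ∀ i, IsHarmonic i (p i)) (f : Finset (Fin n) → ℝ)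
    (hf0 : ∀ U : Finset (Fin n), U.card = t → 0 ≤ f U) (hf1 : ∀ U : Finset (Fin n), U.card = t → f U ≤ 1)
    (hdec : ∀ U ∈ univ.powersetCard t, f U = ∑ i ∈ range (t + 1), zeta (p i) U) (r : ℕ) (hr : 1 ≤ r) :
    (∑ U ∈ univ.powersetCard t, zeta (p j) U ^ 2) / (n.choose t : ℝ) ≤
      sliceMean n t f ^ ((2 : ℝ) - 1 / r) * (n + 1 : ℝ) ^ ((1 : ℝ) / r) *
        (4 * ((2 * r - 1 : ℝ) * (max ((t : ℝ) / n) (1 - (t : ℝ) / n) / min ((t : ℝ) / n) (1 - (t : ℝ) / n)))) ^ j := by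
  have hjt : j ≤ t := by omega
  have htj : t + j ≤ n := by omega
  have h := slice_layer_sq_le_biased ht0 htn hjt htj p hp f hf0 hf1 hdec r hr
  obtain ⟨K, hK⟩ : ∃ K : ℝ, K = (2 * r - 1 : ℝ) * (max ((t : ℝ) / n) (1 - (t : ℝ) / n) / min ((t : ℝ) / n) (1 - (t : ℝ) / n)) :=
    ⟨_, rfl⟩
  rw [← hK] at h ⊢
  have hC : (0 : ℝ) < (n.choose t : ℝ) := by exact_mod_cast Nat.choose_pos htn.le
  have hΛ : transferLambdaBiased n t j ≤ (n.choose t : ℝ) * 4 ^ j := by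
    unfold transferLambdaBiased
    exact mul_le_mul_of_nonneg_left (transferRatio_le_four_pow htn h2jt h2jnt) hC.le
  -- nonnegativity of the prefactor
  have hn' : (0 : ℝ) < n := by exact_mod_cast (lt_of_le_of_lt (Nat.zero_le t) htn)
  have hp0 : 0 < (t : ℝ) / n := div_pos (by exact_mod_cast ht0) hn'
  have hp1 : (t : ℝ) / n < 1 := by rw [div_lt_one hn']; exact_mod_cast htn
  have hK0 : 0 ≤ K := by
    have h2r0 : (0 : ℝ) ≤ 2 * r - 1 := by
      have : (1 : ℝ) ≤ r := by exact_mod_cast hr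
      linarith
    have hmin : 0 < min ((t : ℝ) / n) (1 - (t : ℝ) / n) := lt_min hp0 (by linarith)
    have hmax : 0 ≤ max ((t : ℝ) / n) (1 - (t : ℝ) / n) := hp0.le.trans (le_max_left _ _)
    rw [hK]; positivity
  have hpre : 0 ≤ sliceMean n t f ^ ((2 : ℝ) - 1 / r) * ((n + 1 : ℝ) ^ ((1 : ℝ) / r) * K ^ j) :=
    mul_nonneg (Real.rpow_nonneg (sliceMean_nonneg hf0) _) (mul_nonneg (Real.rpow_nonneg (by positivity) _) (pow_nonneg hK0 _))
  rw [div_le_iff₀ hC]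
  calc ∑ U ∈ univ.powersetCard t, zeta (p j) U ^ 2
      ≤ sliceMean n t f ^ ((2 : ℝ) - 1 / r) * ((n + 1 : ℝ) ^ ((1 : ℝ) / r) * K ^ j) * transferLambdaBiased n t j := h
    _ ≤ sliceMean n t f ^ ((2 : ℝ) - 1 / r) * ((n + 1 : ℝ) ^ ((1 : ℝ) / r) * K ^ j) * ((n.choose t : ℝ) * 4 ^ j) :=
        mul_le_mul_of_nonneg_left hΛ hpre
    _ = sliceMean n t f ^ ((2 : ℝ) - 1 / r) * (n + 1 : ℝ) ^ ((1 : ℝ) / r) * (4 * K) ^ j * (n.choose t : ℝ) := by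
        rw [mul_pow]; ring

/-- **Projection form with explicit constants, logarithmic** (`j ≥ 1`, `2j ≤ min(t, n−t)`): with `L = ln(1/μ)`,
`W_j[f] = Σ_{|U|=t} (zeta p_j U)²/C(n,t) ≤ μ² · (4e · (n+1)^{1/(L+j)} · κ_p · (2L/j + 3))^j`, `κ_p = max(p,1−p)/min(p,1−p)`, `p = t/n`.
[cite: ODonnell2014, §9.5 + Thm. 10.21] -/
theorem slice_layer_weight_le_log_biased {j t : ℕ} (hj : 1 ≤ j) (ht0 : 0 < t) (htn : t < n) (h2jt : 2 * j ≤ t)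
    (h2jnt : 2 * j ≤ n - t) (p : ℕ → Finset (Fin n) → ℝ) (hp : ∀ i, IsHarmonic i (p i)) (f : Finset (Fin n) → ℝ)
    (hf0 : ∀ U : Finset (Fin n), U.card = t → 0 ≤ f U) (hf1 : ∀ U : Finset (Fin n), U.card = t → f U ≤ 1)
    (hdec : ∀ U ∈ univ.powersetCard t, f U = ∑ i ∈ range (t + 1), zeta (p i) U) :
    (∑ U ∈ univ.powersetCard t, zeta (p j) U ^ 2) / (n.choose t : ℝ) ≤
      sliceMean n t f ^ 2 *
        (4 * (Real.exp 1 * (n + 1 : ℝ) ^ (1 / (Real.log (1 / sliceMean n t f) + j)) *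
          (max ((t : ℝ) / n) (1 - (t : ℝ) / n) / min ((t : ℝ) / n) (1 - (t : ℝ) / n)) *
          (2 * Real.log (1 / sliceMean n t f) / j + 3))) ^ j := by
  have hjt : j ≤ t := by omega
  have htj : t + j ≤ n := by omega
  have h := slice_layer_sq_le_log_biased hj ht0 htn hjt htj p hp f hf0 hf1 hdec
  obtain ⟨B, hB⟩ : ∃ B : ℝ, B = Real.exp 1 * (n + 1 : ℝ) ^ (1 / (Real.log (1 / sliceMean n t f) + j)) *
          (max ((t : ℝ) / n) (1 - (t : ℝ) / n) / min ((t : ℝ) / n) (1 - (t : ℝ) / n)) *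
          (2 * Real.log (1 / sliceMean n t f) / j + 3) := ⟨_, rfl⟩
  rw [← hB] at h ⊢
  have hC : (0 : ℝ) < (n.choose t : ℝ) := by exact_mod_cast Nat.choose_pos htn.le
  have hΛ : transferLambdaBiased n t j ≤ (n.choose t : ℝ) * 4 ^ j := by
    unfold transferLambdaBiased
    exact mul_le_mul_of_nonneg_left (transferRatio_le_four_pow htn h2jt h2jnt) hC.le
  have hμ0 : 0 ≤ sliceMean n t f := sliceMean_nonneg hf0
  have hμ1 : sliceMean n t f ≤ 1 := sliceMean_le_one hf1
  have hB0 : 0 ≤ B := by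
    have hn' : (0 : ℝ) < n := by exact_mod_cast (lt_of_le_of_lt (Nat.zero_le t) htn)
    have hp0 : 0 < (t : ℝ) / n := div_pos (by exact_mod_cast ht0) hn'
    have hp1 : (t : ℝ) / n < 1 := by rw [div_lt_one hn']; exact_mod_cast htn
    have hmin : 0 < min ((t : ℝ) / n) (1 - (t : ℝ) / n) := lt_min hp0 (by linarith)
    have hmax : 0 ≤ max ((t : ℝ) / n) (1 - (t : ℝ) / n) := hp0.le.trans (le_max_left _ _)
    have hL : 0 ≤ 2 * Real.log (1 / sliceMean n t f) / j + 3 := by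
      rcases hμ0.eq_or_lt with hz | hpos
      · rw [← hz]; simp
      · have : 0 ≤ Real.log (1 / sliceMean n t f) :=
          Real.log_nonneg (by rw [le_div_iff₀ hpos, one_mul]; exact hμ1)
        positivity
    have hA : 0 ≤ (n + 1 : ℝ) ^ (1 / (Real.log (1 / sliceMean n t f) + j)) := Real.rpow_nonneg (by positivity) _
    rw [hB]; positivity
  have hpre : 0 ≤ sliceMean n t f ^ 2 * B ^ j := mul_nonneg (sq_nonneg _) (pow_nonneg hB0 _)
  rw [div_le_iff₀ hC]
  calc ∑ U ∈ univ.powersetCard t, zeta (p j) U ^ 2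
      ≤ transferLambdaBiased n t j * sliceMean n t f ^ 2 * B ^ j := h
    _ = sliceMean n t f ^ 2 * B ^ j * transferLambdaBiased n t j := by ring
    _ ≤ sliceMean n t f ^ 2 * B ^ j * ((n.choose t : ℝ) * 4 ^ j) := mul_le_mul_of_nonneg_left hΛ hpre
    _ = sliceMean n t f ^ 2 * (4 * B) ^ j * (n.choose t : ℝ) := by rw [mul_pow]; ring

end Literature.Combinatorics.AssociationSchemes.SliceLevelInequalityBiased
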